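import Literature.NumberTheory.Automorphic.LanglandsShelstad1990Descent.Consequences   -- ★ `AdmitsLocalDeltaTransferAtIdentity` (= (1.1) here); transitively ★ `Rogawski1990.LocalTransferExistence` (`TransferFactorData`, `IsDeltaTransferRel`, `IsDeltaTransferExistsRel`, `stableOrbitalIntegralRel`, `OrbitalMeasureFamily`, `classOrbitalIntegral`)
import Literature.NumberTheory.Automorphic.LanglandsShelstad1990Descent.DescentPrinciples   -- ★ `phiH` (= print's `Φ^κ(γ_H, f) = Σ_{γ_G} Δ_loc(γ_H, γ_G) Φ(γ_G, f)`)
import HarnessLib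

/-!
# Langlands–Shelstad, *Orbital integrals on forms of SL(3), II* (1989), §2 «Some easy general cases» — cuspidal endoscopic data,
# LEMMAS 2.1–2.4, COROLLARY 2.5 and the THEOREM of p. 484 («all pairs `(G, H)` with `G` of type `A₂` admit `Δ`-transfer»),
# with the §1 vocabulary they are phrased in (`κ`-germs, stable germs, ASSERTION A)

Topic `NumberTheory/Automorphic/LanglandsShelstad1989`; namespace `Literature.NumberTheory.Automorphic.LanglandsShelstad1989.Sec2`.
STATEMENTS ONLY (carpet, cell `hodgecm-mathlib`, squad TN «LN ∕ LS transfer», seat TN-t11 (g2), DEAL v10): `def`s with bodies, **no theorem,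
no proof, no `sorry`, no `axiom`, no `instance`, no `notation`**.  Source: R. P. Langlands, D. Shelstad, *Orbital integrals on forms of
SL(3), II*, Canad. J. Math. 41 (1989) 480–507 [LanglandsShelstad1989] — HELD page-exact (`lit read doi:10.4153/cjm-1989-022-0` → store key
`paper:langlands1989-orbital-integrals-forms-sl-3-ii`, 28 files, file `pNNNN` = printed page `NNNN + 479`); page pins «(p. N)» are the CJM pages.

## The dress (that of the squad's [LanglandsShelstad1990Descent] files — read ★ `LanglandsShelstad1990Descent/DescentPrinciples.lean` first)

Print (§1, p. 480): «Recall from ([7], Section 2.1) that the problem of local transfer is to show that for any smooth, compactly supported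
function `f` on `G(F)` there is a function `f^H` of the same type on the endoscopic group `H(F)` such that
(1.1) `Φ^st(γ_H, f^H) = Σ Δ_loc(γ_H, γ_G) Φ(γ_G, f)` for all strongly `G`-regular `γ_H` near the identity in `H(F)`.»  Here [7] is
[LanglandsShelstad1990Descent], whose §2.1 (2.1.2) is the tree's ★ `LanglandsShelstad1990Descent.Consequences.AdmitsLocalDeltaTransferAtIdentity` — so (1.1) «local transfer
exists for `H`» IS that predicate, CITED, not restated, and this file speaks the same TRANSFER DRESS (★ `Literature.NumberTheory.Rogawski1990.LocalTransfer`):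
the groups of `F`-points are ABSTRACT topological groups `A` («`H(F)`»), `B` («`G(F)`»), `M i` («`M(F)`», a Levi factor, with its inclusion
`κM i : M i →* B`); «`γ_H` is an image of `γ_G`» is a relation `R`, stable conjugacy in `H(F)` a relation `stA`, «strongly `G`-regular» a
predicate `sregA`, «`G`-regular» on `G(F)` ∕ `M(F)` predicates `regB`, `regM`; the LOCAL transfer factor `Δ_loc(γ_H, γ_G)` of (1.2)–(1.3) is a ★
`TransferFactorData A B R` (a function vanishing off `R`, a class function in each variable — print's `Δ_loc = κ(inv(T_G, γ_G)) D_{G∕H}(γ_G)`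
is such a function; the formula itself, through the `a`-data of [6, §2.3] and [10], is NOT typed: it needs the [LanglandsShelstad1987] carriers);
orbital integrals are ★ `classOrbitalIntegral mG f c` against families ★ `OrbitalMeasureFamily` (PARAMETERS), `Φ^κ(γ_H, f) = Σ_{γ_G} Δ_loc(γ_H, γ_G) Φ(γ_G, f)`
is ★ `DescentPrinciples.phiH Tloc mG f γ_H`, `Φ^st` is ★ `stableOrbitalIntegralRel`, test-function classes `C_c^∞(…)` are predicates `PG`, `PH`,
`PM i` (PARAMETERS; at a finite place ★ `IsLocSmooth`); the unipotent conjugacy classes `𝒪` of `G(F)` (resp. `𝒪_H` of `H(F)`) are a `Finset`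
`U` (resp. `UH`) of `ConjClasses`, their orbital integrals `Φ_𝒪(f)` are `classOrbitalIntegral mG f 𝒪` (the family `mG` carries the invariant
measures on the unipotent orbits too), Shalika germs are class functions `Γ 𝒪 : B → ℂ`, and «near the identity» is `∀ᶠ γ in 𝓝 1`.
Functions print DEFINES get their printed bodies (`kappaGerm` = `Γ^κ_𝒪`, `stableGerm` = `Γ^st`); `D_{G∕M}`, `δ_{G∕M}` are FUNCTIONS given as data.

**Every numbered item is a `def … : Prop` PREDICATE on that explicit data** (squad convention, COORDINATION NOTE 1 (b); precedent ★
`Liu2021.Prop413AsPrinted`): the printed lemma is the assertion that the predicate HOLDS for the data of §1–§2 (a connected reductive — here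
simply connected or of type `A₂` — group `G` over a local field `F` of characteristic zero, endoscopic data `(H, s, ξ)`, the genuine `Δ_loc`,
Haar measures, `C_c^∞`); a consumer takes `(h : Lemma24_kappaGermOne_eq_zero …)` for ITS data; `∀ data, …` is NOT claimed (for the zero factor ★
`TransferFactorData.zero` several items hold vacuously).  Nothing is asserted; no debt is created.

## Census (print item ↦ declaration ↦ page)

| print | declaration | kind |
|---|---|---|
| §1 (1.1) local transfer near the identity (p. 480) | ★ `LanglandsShelstad1990Descent.Consequences.AdmitsLocalDeltaTransferAtIdentity R stA sregA Tloc mH mG PG PH` ([7] (2.1.2)) — CITED, not restated | — |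
| §1 (1.2), (1.3) `Δ_loc(γ_H, γ_G) = κ(inv(T_G, γ_G)) D_{G∕H}(γ_G)` (pp. 481–482) | not typed — the `a`-data ∕ `inv` ∕ Tate–Nakayama calculus of [LanglandsShelstad1987] §2.3, §3; `Δ_loc` enters as the datum `Tloc` | — |
| §1 «the usual germ expansion `Φ(γ_G, f) = Σ_𝒪 Γ_𝒪(γ_G) Φ_𝒪(f)`» (p. 482) | `HasGermExpansionAtIdentity` | def (Prop) |
| §1 `Φ^κ(γ_H, f) = Σ_{γ_G} Δ_loc(γ_H, γ_G) Φ(γ_G, f)` (p. 482) | ★ `LanglandsShelstad1990Descent.DescentPrinciples.phiH Tloc mG f` — CITED | — |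
| §1 the `κ`-germ `Γ^κ_𝒪(γ_H)` and its expansion (p. 482) | `kappaGerm`, `HasKappaGermExpansionAtIdentity` | def, def (Prop) |
| §1 «the stable germs `Γ^st_𝒪`» (`H = G*`, all `κ` trivial) (p. 482) | `stableGerm` | def |
| §1 ASSERTION A (p. 482) | `AssertionA` | def (Prop) |
| §1 «local transfer for `H` and all `f` ⟺ Assertion A for all `𝒪`» (p. 482) | `Sec1_localTransfer_iff_assertionA` | def (Prop) |
| §2 «cuspidal» endoscopic data (p. 482) | — (a condition on the algebraic groups: «the maximal split subgroup `S_H` of the center of `H` is contained in the center of `G`»; it is the standing hypothesis, in words, of `Lemma21_nonCuspidalDescent`) | not typed |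
| §2 (2.1) `D_{G∕M}(γ) Φ(γ, f) = Φ(γ, f^M)`; «we can take `f^M(m) = c δ_{G∕M}(m) ∫_K ∫_{N(F)} f(k⁻¹mnk) dn dk`» (p. 483) | `IsParabolicDescent`, `ParabolicDescentExists` (the explicit constant term is NOT typed: Haar measures on `K`, `N(F)`) | def (Prop) |
| §2 «`Δ(γ_H, γ) = Δ^M(γ_H, γ) D_{G∕M}(γ)`» ([7]) (p. 483) | hypothesis `hΔM` inside `Lemma21_nonCuspidalDescent` | — |
| LEMMA 2.1 (p. 482; proof pp. 482–483) | `Lemma21_nonCuspidalDescent` | def (Prop) |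
| LEMMA 2.2 (p. 483) — from [LanglandsShelstad1987, Thm. 5.5.A] = ★ `LanglandsShelstad1987.RegularUnipotent.Thm55ALimitFormula` | `Lemma22_regularUnipotent` | def (Prop) |
| LEMMA 2.3 (p. 483) | `Lemma23_trivialClass` | def (Prop) |
| LEMMA 2.4 «If `H ≠ G*` then `Γ^κ_1 = 0`» (p. 484) | `Lemma24_kappaGermOne_eq_zero` | def (Prop) |
| COROLLARY 2.5 «`G` anisotropic modulo its center ⇒ local transfer exists for all `H`» (p. 484) | `Cor25_anisotropicModCentre` (= ★ `AdmitsLocalDeltaTransferAtIdentity` at the data, named so that print's hypothesis travels with the cite) | def (Prop) |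
| §2 «if local transfer is possible for the pair `G_sc, H_sc` then it is possible for `G, H`» ([7]) (p. 484) | `Sec2_localTransfer_of_scPair` | def (Prop) |
| §2 «In treating forms of SL(3), we need only consider cuspidal endoscopic groups and subregular classes `𝒪`» (p. 484) | — (the bookkeeping Lemma 2.1 + Cor. 2.5 + Lemmas 2.2–2.4; the subregular case is §§3–9, Lemmas 4.1–4.2) | not typed |
| THEOREM (p. 484, unnumbered) «If `G` is of type `A₂` then all pairs `(G, H)` admit `Δ`-transfer» | `Theorem_typeA2_DeltaTransfer` (★ `IsDeltaTransferExistsRel`, [7] (2.1.1)) and its local form `Theorem_typeA2_localTransfer` (★ `AdmitsLocalDeltaTransferAtIdentity`, (1.1)) — see «What p. 484 asserts» | def (Prop) |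

## What p. 484 asserts, and what it says about dyadic `F` (for the consumers)

The THEOREM is stated for `G` of type `A₂` over a local field `F` of CHARACTERISTIC ZERO (the standing hypothesis of [6], [7] and of the
closing LEMMA p. 506 «For any local field of characteristic zero …»), any endoscopic `H`.  Archimedean `F`: «the existence of the transfer over
archimedean fields is a result of earlier work by Shelstad» (§0 p. 480).  Non-archimedean `F`: this paper proves LOCAL transfer at the identity
(1.1) — i.e. Assertion A for every unipotent `𝒪` — for the forms of SL(3) (§0: «we solve this local problem for two special cases, the group SL(3)
… and the group SU(3)»; §2: non-cuspidal `H` by Lemma 2.1, anisotropic `G` by Cor. 2.5, `𝒪` regular ∕ trivial by Lemmas 2.2–2.4, `𝒪` subregular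
and `H` cuspidal by Lemmas 4.1–4.2 and §§5–9), passes to every `(G, H)` with `G` of type `A₂` through `(G_sc, H_sc)` ([7]), and concludes
`Δ`-transfer by [7] = [LanglandsShelstad1990Descent, Thm. 2.3.A] (★ `LanglandsShelstad1990Descent_2_3_A_reductionToLocalTransfer`).  **NO restriction on the residual characteristic is made
anywhere: the one parity-sensitive constant (`|2|_N` in Lemma 4.2, p. 506) is computed by the closing LEMMA p. 506 separately «for a field with
odd residual characteristic» and «if the residual characteristic is even».  So p. 484 covers DYADIC `F`** — which is exactly what the tree's
consumers take from it: ★ `Rogawski1990.LocalTransferExplicitNonsplit` ∕ `…NonsplitClosed` («The existence of `f^H` in the *p*-adic case is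
contained in [LS₂]»; «at a non-split `v` this is the Langlands–Shelstad transfer for the elliptic endoscopic pair `(U(3), U(2) × U(1))` over `L⁺_v`
([LS₂] Theorem, end of §2, p. 484: all pairs `(G, H)` with `G` of type `A₂` admit `Δ`-transfer)»), ★ `Rogawski1990.LocalTransferIdentityCoreResidualStatements`
(«a non-split DYADIC `v` … `φ ∈ C_c^∞(G′_v)` admits `V ∈ 𝓝 1` and `φH ∈ C_c^∞(H_v)` with `SO_{γH}(φH) = Σ_c Δ‴_v(γH, c)·O_c(φ)` for all `G`-regular
`γH ∈ V`.  PERMANENT (Langlands–Shelstad transfer for type `A₂`, «(G′_v, H_v) admits local Δ-transfer at the identity»)»), and the Line stubs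
`F0_P3a_N6nsGerm.stub_N6nsDyadic` («(S3) THE IDENTITY CORE AT THE DYADIC NON-SPLIT PLACES (PRINT — the permanent residual of [LS₂] …)»),
`F0_U3LettersRung1.stub_N6ns`.  Their conclusion `∀ φ, IsLocSmooth φ → ∃ V ∈ 𝓝 1, ∃ φH, IsLocSmooth φH ∧ ∀ γH ∈ V, G-regular γH → SO = Σ Δ‴·O`
is token-for-token `Theorem_typeA2_localTransfer` (= ★ `AdmitsLocalDeltaTransferAtIdentity` with ★ `IsDeltaTransferRel` unfolded) at `A = H_v`,
`B = G′_v = U(H′)(L⁺_v)` (a group of type `A₂`), `Tloc = Δ‴_v`, `PG = PH = IsLocSmooth`; the concrete CLOSED `U(3)` instances already in the tree are ★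
`Rogawski1990.LocalTransferExplicitClosed` ∕ ★ `LocalTransferExplicitNonsplitClosed` (named facts).  LOCATOR NOTE: four tree tags read
«[cite: LanglandsShelstad1989, Thm. 6.2]» (★ `Rogawski1990/LocalTransferUnitExplicitFactor` ×2, ★ `…/UnitFundamentalLemmaOffFiniteSetAssembly`,
Line `F0_P3a_GlobalTransferCartanKappaPaydown`) — this paper has NO Theorem 6.2 (§6 «The fibres» carries only equation (6.2)); they mean the
p. 484 Theorem (they stand next to «Prop. 4.9.1 (a) … is contained in [LS₂]») and should be re-pinned «Theorem (end of §2, p. 484)» at their next edition.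

## References
* [LanglandsShelstad1989] R. P. Langlands, D. Shelstad, *Orbital integrals on forms of SL(3), II*, Canad. J. Math. 41 (1989) 480–507: §0 p. 480,
  §1 pp. 480–482, §2 pp. 482–484, §4 Lemmas 4.1–4.2 pp. 486–487, closing Lemma p. 506.
* [LanglandsShelstad1990Descent] (print's [7]) R. P. Langlands, D. Shelstad, *Descent for transfer factors*, Progr. Math. 87 (1990) 485–563, §2.1, Thm. 2.3.A.
* [LanglandsShelstad1987] (print's [6]) R. P. Langlands, D. Shelstad, *On the definition of transfer factors*, Math. Ann. 278 (1987) 219–271, Thm. 5.5.A.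
* [Rogawski1990] (print's [9]) J. D. Rogawski, *Automorphic Representations of Unitary Groups in Three Variables*, Ann. of Math. Stud. 123 (1990),
  §4.3 (4.3.1), §4.9 Prop. 4.9.1 (a) (the tree's transfer dress and its `U(3)` consumers).
-/

noncomputable section

open Filter Topology

namespace Literature.NumberTheory.Automorphic.LanglandsShelstad1989.Sec2

open Literature.NumberTheory.Rogawski1990 (TransferFactorData IsDeltaTransferRel IsDeltaTransferExistsRel stableOrbitalIntegralRel)
open Literature.NumberTheory.Automorphic.LanglandsShelstad1990Descent.Consequences (AdmitsLocalDeltaTransferAtIdentity)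
open Literature.NumberTheory.Automorphic.LanglandsShelstad1990Descent.DescentPrinciples (phiH)

universe u

/-! ## §1 vocabulary: germ expansions, `κ`-germs, stable germs, ASSERTION A (pp. 480–482) -/

section Germs

variable {A B : Type*} [Group A] [Group B] [TopologicalSpace A] [TopologicalSpace B]
  [∀ a : A, MeasurableSpace (A ⧸ Subgroup.centralizer ({a} : Set A))]
  [∀ b : B, MeasurableSpace (B ⧸ Subgroup.centralizer ({b} : Set B))]
  {R : A → B → Prop}

/-- **§1, «The usual germ expansion on `G(F)` is `Φ(γ_G, f) = Σ_𝒪 Γ_𝒪(γ_G) Φ_𝒪(f)`» (p. 482)** — the Shalika germ expansion at the identity,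
which print USES (it is not a result of the paper).  TRANSFER DRESS: `B` = «`G(F)`», `U` = the (finitely many) unipotent conjugacy classes `𝒪`,
`Γ 𝒪 : B → ℂ` the germ of `𝒪` (a class function, meaningful on the `G`-regular elements near `1`), `Φ_𝒪(f)` = ★ `classOrbitalIntegral mG f 𝒪`,
`Φ(γ_G, f)` = ★ `classOrbitalIntegral mG f [γ_G]`, `regB` = «regular semisimple», `PG` = «`C_c^∞(G(F))`»; the neighbourhood of `1` on which the
expansion holds depends on `f` (`∀ f, ∀ᶠ γ in 𝓝 1`).  The predicate says: `Γ` IS a family of germs for `(G(F), mG, U, PG)`.  (The tree's concrete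
`U(3)` edition of the same statement is ★ `Rogawski1990.ShalikaGermExpansionNonsplit`, [Rogawski1990, Prop. 8.1.1].)
[cite: LanglandsShelstad1989, §1 (p. 482)] [cite: Rogawski1990, §8.1 Prop. 8.1.1 p. 112] -/
def HasGermExpansionAtIdentity (regB : B → Prop) (mG : OrbitalMeasureFamily B) (U : Finset (ConjClasses B))
    (Γ : ConjClasses B → B → ℂ) (PG : (B → ℂ) → Prop) : Prop :=
  ∀ f : B → ℂ, PG f → ∀ᶠ γ in 𝓝 (1 : B), regB γ →
    classOrbitalIntegral mG f (ConjClasses.mk γ) = ∑ 𝒪 ∈ U, Γ 𝒪 γ * classOrbitalIntegral mG f 𝒪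

/-- **§1, the `κ`-germ `Γ^κ_𝒪` (p. 482)**: «`Γ^κ_𝒪(γ_H) = κ(inv(T_G, γ_G)) D_{G∕H}(γ_G) Σ_{δ ∈ 𝔈(T_G)} κ(δ) Γ_𝒪(γ_G^δ)` if `γ_H` is an image of an
element of `G`. Otherwise `Γ^κ_𝒪(γ_H) = 0`. It will be referred to as the `κ` germ-expansion, and the `Γ^κ_𝒪` as `κ`-germs».  PRINTED BODY, with
print's own (1.3) «`Δ_loc(γ_H, γ_G) = κ(inv(T_G, γ_G)) D_{G∕H}(γ_G)`» (p. 482; `inv(T_G, γ_G^δ) = inv(T_G, γ_G)·δ`, `D_{G∕H}(γ_G^δ) = D_{G∕H}(γ_G)`)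
substituted — print itself records «`Δ_loc(γ_H, γ_G^δ) = κ(δ) Δ_loc(γ_H, γ_G)`» (p. 481, from [6, Section 3.4]) — because the dress carries `Δ_loc`
as the datum `Tloc` (★ `TransferFactorData`) and not `inv`, `κ`, `D_{G∕H}` separately: `Γ^κ_𝒪(γ_H) = Σ_{[γ_G]} Δ_loc(γ_H, γ_G) Γ_𝒪(γ_G)`, the `finsum`
over ALL conjugacy classes of `B` = «`G(F)`» (`Δ_loc` vanishes off the classes matching `γ_H`, `Tloc.eq_zero_of_not_rel`, so this is print's sum over
`𝔈(T_G)`, and it is `0` when `γ_H` is not an image, as printed); `Γ𝒪 : B → ℂ` is the germ of ONE class `𝒪` (a class function, evaluated at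
representatives).  Same shape as ★ `phiH` with `Φ(·, f)` replaced by `Γ_𝒪`. [cite: LanglandsShelstad1989, §1 (pp. 481–482); (1.3) (p. 482)] -/
def kappaGerm (Tloc : TransferFactorData A B R) (Γ𝒪 : B → ℂ) (γH : A) : ℂ :=
  ∑ᶠ c : ConjClasses B, Tloc.Δ γH (Quotient.out c) * Γ𝒪 (Quotient.out c)

/-- **§1, the `κ` germ-expansion (p. 482)**: «The germ expansion for `Φ^κ(γ_H, f) = Σ_{γ_G} Δ_loc(γ_H, γ_G) Φ(γ_G, f)` is
`Φ^κ(γ_H, f) = Σ_𝒪 Γ^κ_𝒪(γ_H) Φ_𝒪(f)`» with the `κ`-germs `kappaGerm`.  TRANSFER DRESS: `Φ^κ(γ_H, f)` = ★ `phiH Tloc mG f γ_H`; the expansion holds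
for `f ∈ PG` at the strongly `G`-regular `γ_H` (`sregA`) near `1 ∈ A` = «`H(F)`» (it follows from `HasGermExpansionAtIdentity` by linearity — print
states it, the implication is not proved here). [cite: LanglandsShelstad1989, §1 (p. 482)] -/
def HasKappaGermExpansionAtIdentity (sregA : A → Prop) (Tloc : TransferFactorData A B R) (mG : OrbitalMeasureFamily B)
    (U : Finset (ConjClasses B)) (Γ : ConjClasses B → B → ℂ) (PG : (B → ℂ) → Prop) : Prop :=
  ∀ f : B → ℂ, PG f → ∀ᶠ γH in 𝓝 (1 : A), sregA γH →
    phiH Tloc mG f γH = ∑ 𝒪 ∈ U, kappaGerm Tloc (Γ 𝒪) γH * classOrbitalIntegral mG f 𝒪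

/-- **§1, stable germs (p. 482)**: «Taking `H = G*`, so that all the `κ` are trivial, we obtain the stable germs `Γ^st_𝒪`.»  With `κ ≡ 1` and
`D_{G∕G*} ≡ 1` on matching regular elements the printed body of `Γ^κ_𝒪` becomes `Γ^st_𝒪(γ) = Σ_{δ} Γ_𝒪(γ^δ)`, the sum of the germ over the
conjugacy classes in the STABLE class of `γ`.  Typed for a group `A` with its stable-conjugacy relation `stA` (it is used below for the endoscopic
group `H(F)` — «stable germs for `H`» — `H` being quasi-split, `H* = H`): the `finsum` over the conjugacy classes `c` of `A` with `stA γ (out c)` of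
`Γ_𝒪(out c)` — the shape of ★ `stableOrbitalIntegralRel` with `Φ(·, f)` replaced by the germ `Γ𝒪 : A → ℂ`.
[cite: LanglandsShelstad1989, §1 (p. 482)] -/
def stableGerm (stA : A → A → Prop) (Γ𝒪 : A → ℂ) (γ : A) : ℂ :=
  ∑ᶠ c ∈ {c : ConjClasses A | stA γ (Quotient.out c)}, Γ𝒪 (Quotient.out c)

/-- **§1, ASSERTION A (p. 482)**, for ONE unipotent class `𝒪` of `G(F)` and the endoscopic group `H`: «The `κ`-germ `Γ^κ_𝒪` is a linear
combination of stable germs for `H`.»  TRANSFER DRESS: `Γ𝒪 : B → ℂ` the germ of `𝒪` on `G(F)`, `UH` the unipotent classes `𝒪_H` of `H(F)` with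
germs `ΓH 𝒪_H : A → ℂ`, «stable germs for `H`» = `stableGerm stA (ΓH 𝒪_H)`; as an identity of GERMS at the identity: there are coefficients
`a 𝒪_H ∈ ℂ` with `Γ^κ_𝒪(γ_H) = Σ_{𝒪_H ∈ UH} a_{𝒪_H} Γ^{st}_{𝒪_H}(γ_H)` for all strongly `G`-regular `γ_H` near `1` in `H(F)`.
[cite: LanglandsShelstad1989, §1, Assertion A (p. 482)] -/
def AssertionA (sregA : A → Prop) (stA : A → A → Prop) (Tloc : TransferFactorData A B R) (Γ𝒪 : B → ℂ)
    (UH : Finset (ConjClasses A)) (ΓH : ConjClasses A → A → ℂ) : Prop :=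
  ∃ a : ConjClasses A → ℂ, ∀ᶠ γH in 𝓝 (1 : A), sregA γH →
    kappaGerm Tloc Γ𝒪 γH = ∑ 𝒪H ∈ UH, a 𝒪H * stableGerm stA (ΓH 𝒪H) γH

/-- **§1, last sentence (p. 482)**: «The existence of the local transfer for a group `H` and all `f` is clearly equivalent to the validity of the
following assertion for all `𝒪`» (ASSERTION A).  TRANSFER DRESS: «local transfer for `H` and all `f`» = (1.1) = ★ `AdmitsLocalDeltaTransferAtIdentity`
([LanglandsShelstad1990Descent] (2.1.2)); presupposed, as in print, are the germ expansions on `G(F)` (`HasGermExpansionAtIdentity regB mG U Γ PG`)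
and on `H(F)` (`HasGermExpansionAtIdentity regA mH UH ΓH PH`, whence the stable germs for `H`), entered as hypotheses.  A predicate on the data;
print asserts it for `F` non-archimedean, `PG = C_c^∞(G(F))`, `PH = C_c^∞(H(F))`, the genuine germs and `Δ_loc`.
[cite: LanglandsShelstad1989, §1 (p. 482)] [cite: LanglandsShelstad1990Descent, §2.1 (2.1.2) (typescript p. 10)] -/
def Sec1_localTransfer_iff_assertionA (R : A → B → Prop) (stA : A → A → Prop) (sregA regA : A → Prop) (regB : B → Prop)
    (Tloc : TransferFactorData A B R) (mH : OrbitalMeasureFamily A) (mG : OrbitalMeasureFamily B) (PG : (B → ℂ) → Prop)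
    (PH : (A → ℂ) → Prop) (U : Finset (ConjClasses B)) (Γ : ConjClasses B → B → ℂ) (UH : Finset (ConjClasses A))
    (ΓH : ConjClasses A → A → ℂ) : Prop :=
  HasGermExpansionAtIdentity regB mG U Γ PG → HasGermExpansionAtIdentity regA mH UH ΓH PH →
    (AdmitsLocalDeltaTransferAtIdentity R stA sregA Tloc mH mG PG PH ↔ ∀ 𝒪 ∈ U, AssertionA sregA stA Tloc (Γ 𝒪) UH ΓH)

end Germs

/-! ## §2 (2.1): parabolic descent of orbital integrals to a Levi factor `M` (p. 483) -/

section Levi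

variable {B M : Type*} [Group B] [Group M]
  [∀ b : B, MeasurableSpace (B ⧸ Subgroup.centralizer ({b} : Set B))]
  [∀ m : M, MeasurableSpace (M ⧸ Subgroup.centralizer ({m} : Set M))]

/-- **§2, formula (2.1) for ONE pair `(f, f^M)` (p. 483)**: «(2.1) `D_{G∕M}(γ) Φ(γ, f) = Φ(γ, f^M)`», where (p. 483) `M` is a Levi factor of a
proper parabolic subgroup `P` of `G` over `F`, `D_{G∕M}(m) = |det(1 − Ad m)|_{𝔤∕𝔪}|^{1∕2}`, `Φ(γ, f)` is the orbital integral in `G(F)` and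
`Φ(γ, f^M)` the one in `M(F)`, for `G`-regular `γ ∈ M(F)`.  TRANSFER DRESS: `M` = «`M(F)`» with its inclusion `κM : M →* B` into «`G(F)`», `DGM` =
«`D_{G∕M}`» (a FUNCTION given as data), `regM` = «`G`-regular elements of `M(F)`», `mG` ∕ `mM` the orbital measure families of `G(F)` ∕ `M(F)`.
[cite: LanglandsShelstad1989, §2 (2.1) (p. 483)] -/
def IsParabolicDescent (κM : M →* B) (regM : M → Prop) (DGM : M → ℂ) (mG : OrbitalMeasureFamily B) (mM : OrbitalMeasureFamily M)
    (f : B → ℂ) (fM : M → ℂ) : Prop :=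
  ∀ γ : M, regM γ → DGM γ * classOrbitalIntegral mG f (ConjClasses.mk (κM γ)) = classOrbitalIntegral mM fM (ConjClasses.mk γ)

/-- **§2, existence of `f^M` with (2.1) (p. 483)**: «we need only verify the existence of a smooth compactly supported function `f^M` on `M(F)` such
that (2.1) … However, it is well known that for this purpose we can take `f^M(m) = c δ_{G∕M}(m) ∫_K ∫_{N(F)} f(k⁻¹mnk) dn dk`, with a suitable constant
`c`» (`δ_{G∕M}(m) = |det m|_𝔫|^{1∕2}`, `𝔫` the Lie algebra of the unipotent radical of `P`).  TYPED as the existence statement print uses: every `f ∈ PG`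
(«`C_c^∞(G(F))`») has an `f^M ∈ PM` («`C_c^∞(M(F))`») with `IsParabolicDescent`; the explicit constant-term formula is NOT typed (it needs the Haar
measures on `K` and `N(F)`).  A predicate on the data; print asserts it («well known») for a Levi factor of a proper parabolic of a connected
reductive `G` over a local field. [cite: LanglandsShelstad1989, §2 (2.1) (p. 483)] -/
def ParabolicDescentExists (κM : M →* B) (regM : M → Prop) (DGM : M → ℂ) (mG : OrbitalMeasureFamily B) (mM : OrbitalMeasureFamily M)
    (PG : (B → ℂ) → Prop) (PM : (M → ℂ) → Prop) : Prop :=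
  ∀ f : B → ℂ, PG f → ∃ fM : M → ℂ, PM fM ∧ IsParabolicDescent κM regM DGM mG mM f fM

end Levi

/-! ## §2 LEMMA 2.1: non-cuspidal `H` (pp. 482–483) -/

section NonCuspidal

variable {A B : Type*} [Group A] [Group B] [TopologicalSpace A]
  [∀ a : A, MeasurableSpace (A ⧸ Subgroup.centralizer ({a} : Set A))]
  [∀ b : B, MeasurableSpace (B ⧸ Subgroup.centralizer ({b} : Set B))]
  {ι : Type*} {M : ι → Type u} [∀ i, Group (M i)]
  [∀ i (m : M i), MeasurableSpace (M i ⧸ Subgroup.centralizer ({m} : Set (M i)))]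

/-- **LEMMA 2.1 (p. 482)**: «Suppose `H` is not cuspidal. If local transfer exists for all endoscopic groups of all Levi factors of proper parabolic
subgroups of `G` then it exists for `H`.»  («The endoscopic group `H`, or the data defining it, will be said to be cuspidal if the maximal split
subgroup `S_H` of the center of `H` is contained in the center of `G`», p. 482.)  Print's proof (pp. 482–483): `S_H` transports to a non-central
split torus `S_G`, `M = Cent(S_G)` is a Levi factor of a proper parabolic over `F`, `H` is endoscopic for `M`, every image Cartan subgroup is the
image of one inside `M`, «We can easily arrange [7] `Δ(γ_H, γ) = Δ^M(γ_H, γ) D_{G∕M}(γ)`», and (2.1) turns a transfer `f^M ↦ (f^M)^H` for `(M, H)` into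
one for `(G, H)`.  TRANSFER DRESS, for a FAMILY of Levi data `i : ι` (print's «all Levi factors of proper parabolic subgroups» for which `H` is
endoscopic): `M i` = «`M(F)`» with `κM i : M i →* B`, its matching relation `RM i` and local factor `TM i` = «`Δ^M`» on `A × M i`, `DGM i` = «`D_{G∕M}`»,
`regM i`, `mM i`, `PM i` = «`C_c^∞(M(F))`»; hypotheses = the two printed equations — `hΔM`: `Δ_loc(γ_H, γ) = Δ^M(γ_H, γ) D_{G∕M}(γ)` for `γ ∈ M(F)`,
and (2.1) `ParabolicDescentExists` — and local transfer (1.1) for every `(M i, H)`; conclusion = local transfer (1.1) for `(G, H)`.  A predicate on the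
data; print asserts it for `H` NOT cuspidal (for cuspidal `H` there is no such Levi datum and the content is empty).
[cite: LanglandsShelstad1989, Lemma 2.1 (p. 482); (2.1) (p. 483)] [cite: LanglandsShelstad1990Descent, §2.1 (2.1.2) (typescript p. 10)] -/
def Lemma21_nonCuspidalDescent (R : A → B → Prop) (stA : A → A → Prop) (sregA : A → Prop) (Tloc : TransferFactorData A B R)
    (mH : OrbitalMeasureFamily A) (mG : OrbitalMeasureFamily B) (PG : (B → ℂ) → Prop) (PH : (A → ℂ) → Prop)
    (κM : ∀ i, M i →* B) (regM : ∀ i, M i → Prop) (DGM : ∀ i, M i → ℂ) (mM : ∀ i, OrbitalMeasureFamily (M i))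
    (PM : ∀ i, (M i → ℂ) → Prop) (RM : ∀ i, A → M i → Prop) (TM : ∀ i, TransferFactorData A (M i) (RM i)) : Prop :=
  (∀ i (a : A) (m : M i), Tloc.Δ a (κM i m) = (TM i).Δ a m * DGM i m) →
    (∀ i, ParabolicDescentExists (κM i) (regM i) (DGM i) mG (mM i) PG (PM i)) →
      (∀ i, AdmitsLocalDeltaTransferAtIdentity (RM i) stA sregA (TM i) mH (mM i) (PM i) PH) →
        AdmitsLocalDeltaTransferAtIdentity R stA sregA Tloc mH mG PG PH

end NonCuspidal

/-! ## §2 LEMMAS 2.2–2.4, COROLLARY 2.5 and the THEOREM (pp. 483–484) -/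

section EasyCases

variable {A B : Type*} [Group A] [Group B] [TopologicalSpace A]
  [∀ a : A, MeasurableSpace (A ⧸ Subgroup.centralizer ({a} : Set A))]
  [∀ b : B, MeasurableSpace (B ⧸ Subgroup.centralizer ({b} : Set B))]
  {R : A → B → Prop}

/-- **LEMMA 2.2 (p. 483)**: «Assertion A is valid for regular unipotent classes `𝒪` and all `H`.»  «This follows readily from Theorem 5.5.A of [6]»
([LanglandsShelstad1987, Thm. 5.5.A] = squad file ★ `LanglandsShelstad1987.RegularUnipotent.Thm55ALimitFormula`).  TRANSFER DRESS: `Ureg` = the REGULAR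
unipotent classes of `G(F)` (a parameter), `Γ 𝒪` their germs; `AssertionA` for each `𝒪 ∈ Ureg`.  A predicate on the data; print asserts it for every
endoscopic `H` of a connected reductive `G` over non-archimedean `F` of characteristic zero.
[cite: LanglandsShelstad1989, Lemma 2.2 (p. 483)] [cite: LanglandsShelstad1987, Theorem 5.5.A (p. 262)] -/
def Lemma22_regularUnipotent (sregA : A → Prop) (stA : A → A → Prop) (Tloc : TransferFactorData A B R)
    (Ureg : Finset (ConjClasses B)) (Γ : ConjClasses B → B → ℂ) (UH : Finset (ConjClasses A)) (ΓH : ConjClasses A → A → ℂ) : Prop :=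
  ∀ 𝒪 ∈ Ureg, AssertionA sregA stA Tloc (Γ 𝒪) UH ΓH

/-- **LEMMA 2.3 (p. 483)**: «Assertion A is valid for the class `𝒪 = {1}` and all `H`.»  (Proof: «By results of Howe, Harish-Chandra and Rogawski,
`Γ_1` vanishes on tori that are not anisotropic, and is a constant `c_G` on all anisotropic tori. Moreover `c_G = c_{G*}` for compatible choices of
the measures»; for `H ≠ G*` the stronger Lemma 2.4.)  TRANSFER DRESS: `AssertionA` for the germ `Γ [1]` of the trivial class `ConjClasses.mk 1`.
A predicate on the data; print asserts it for every endoscopic `H`. [cite: LanglandsShelstad1989, Lemma 2.3 (p. 483)] -/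
def Lemma23_trivialClass (sregA : A → Prop) (stA : A → A → Prop) (Tloc : TransferFactorData A B R) (Γ : ConjClasses B → B → ℂ)
    (UH : Finset (ConjClasses A)) (ΓH : ConjClasses A → A → ℂ) : Prop :=
  AssertionA sregA stA Tloc (Γ (ConjClasses.mk 1)) UH ΓH

/-- **LEMMA 2.4 (p. 484)**: «If `H ≠ G*` then `Γ^κ_1 = 0`.»  (Proof: «On tori that are not anisotropic this is a consequence of (2.1). On the other
hand, for an anisotropic torus `T` the group `𝔇(T) ≅ 𝔈(T_G)` is a quotient of `X_*(T_ad)`. Since `H ≠ G*` the character `κ` is not trivial on `𝔇(T_G)`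
and `Σ κ(δ) Γ_1 = 0`.»)  TRANSFER DRESS: the `κ`-germ of the trivial class, `kappaGerm Tloc (Γ [1])`, vanishes as a germ at the identity — at every
strongly `G`-regular `γ_H` near `1` in `H(F)`.  A predicate on the data; print asserts it for `H ≠ G*` (for `H = G*` it fails: `Γ^κ_1 = Γ^st_1` is the
non-zero constant `c_G` on anisotropic tori, Lemma 2.3). [cite: LanglandsShelstad1989, Lemma 2.4 (p. 484)] -/
def Lemma24_kappaGermOne_eq_zero (sregA : A → Prop) (Tloc : TransferFactorData A B R) (Γ : ConjClasses B → B → ℂ) : Prop :=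
  ∀ᶠ γH in 𝓝 (1 : A), sregA γH → kappaGerm Tloc (Γ (ConjClasses.mk 1)) γH = 0

/-- **COROLLARY 2.5 (p. 484)**: «If `G` is anisotropic modulo its center then local transfer exists for all `H`.»  (From Lemmas 2.3–2.4: an anisotropic
`G` has no unipotent class but `{1}`.)  TRANSFER DRESS: «local transfer exists for `H`» = (1.1) = ★ `AdmitsLocalDeltaTransferAtIdentity` at the data of
`(G, H)`; the hypothesis «`G` anisotropic modulo its center» is a condition on the algebraic group and travels with this name and cite, in words —
the body is the tree's predicate (nothing new is defined; the declaration exists so that the printed Corollary can be cited BY NAME).  Print asserts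
it for `G` connected reductive anisotropic modulo centre over non-archimedean `F` of characteristic zero, any endoscopic `H`.
[cite: LanglandsShelstad1989, Corollary 2.5 (p. 484)] [cite: LanglandsShelstad1990Descent, §2.1 (2.1.2) (typescript p. 10)] -/
def Cor25_anisotropicModCentre (R : A → B → Prop) (stA : A → A → Prop) (sregA : A → Prop) (Tloc : TransferFactorData A B R)
    (mH : OrbitalMeasureFamily A) (mG : OrbitalMeasureFamily B) (PG : (B → ℂ) → Prop) (PH : (A → ℂ) → Prop) : Prop :=
  AdmitsLocalDeltaTransferAtIdentity R stA sregA Tloc mH mG PG PH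

end EasyCases

section SimplyConnected

variable {A B Asc Bsc : Type*} [Group A] [Group B] [Group Asc] [Group Bsc] [TopologicalSpace A] [TopologicalSpace Asc]
  [∀ a : A, MeasurableSpace (A ⧸ Subgroup.centralizer ({a} : Set A))]
  [∀ b : B, MeasurableSpace (B ⧸ Subgroup.centralizer ({b} : Set B))]
  [∀ a : Asc, MeasurableSpace (Asc ⧸ Subgroup.centralizer ({a} : Set Asc))]
  [∀ b : Bsc, MeasurableSpace (Bsc ⧸ Subgroup.centralizer ({b} : Set Bsc))]

/-- **§2, p. 484 (from [7])**: «every endoscopic group `H` of `G` arises in a natural way from some `H_sc` for `G_sc`, and … it follows readily from [7]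
that if local transfer is possible for the pair `G_sc, H_sc` then it is possible for `G, H`.»  TRANSFER DRESS: two pairs — `(Asc, Bsc)` = «`(H_sc(F),
G_sc(F))`» with its data `(Rsc, stAsc, sregAsc, Tsc, mHsc, mGsc, PGsc, PHsc)` and `(A, B)` = «`(H(F), G(F))`» with its data; the implication between the
two local-transfer statements (1.1).  The LINK between the pairs (the isogeny `G_sc → G`, `H_sc → H` and the comparison of the factors) is print's
proof via [7], not a hypothesis: a predicate on the data, asserted by print for the genuine `(G_sc, H_sc) → (G, H)`.
[cite: LanglandsShelstad1989, §2 (p. 484)] [cite: LanglandsShelstad1990Descent, §2.1 (2.1.2) (typescript p. 10)] -/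
def Sec2_localTransfer_of_scPair (Rsc : Asc → Bsc → Prop) (stAsc : Asc → Asc → Prop) (sregAsc : Asc → Prop)
    (Tsc : TransferFactorData Asc Bsc Rsc) (mHsc : OrbitalMeasureFamily Asc) (mGsc : OrbitalMeasureFamily Bsc)
    (PGsc : (Bsc → ℂ) → Prop) (PHsc : (Asc → ℂ) → Prop)
    (R : A → B → Prop) (stA : A → A → Prop) (sregA : A → Prop) (Tloc : TransferFactorData A B R)
    (mH : OrbitalMeasureFamily A) (mG : OrbitalMeasureFamily B) (PG : (B → ℂ) → Prop) (PH : (A → ℂ) → Prop) : Prop :=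
  AdmitsLocalDeltaTransferAtIdentity Rsc stAsc sregAsc Tsc mHsc mGsc PGsc PHsc →
    AdmitsLocalDeltaTransferAtIdentity R stA sregA Tloc mH mG PG PH

end SimplyConnected

section TheTheorem

variable {A B : Type*} [Group A] [Group B] [TopologicalSpace A]
  [∀ a : A, MeasurableSpace (A ⧸ Subgroup.centralizer ({a} : Set A))]
  [∀ b : B, MeasurableSpace (B ⧸ Subgroup.centralizer ({b} : Set B))]

/-- **THEOREM (p. 484, end of §2, unnumbered)**: «If `G` is of type `A₂` then all pairs `(G, H)` admit `Δ`-transfer.»  («Thus we shall eventually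
obtain the following statement» — the conjunction of Lemma 2.1, Cor. 2.5, Lemmas 2.2–2.4, Lemmas 4.1–4.2 with §§5–9, the passage `(G_sc, H_sc) → (G, H)`
and [7] = [LanglandsShelstad1990Descent, Thm. 2.3.A]; archimedean `F` by Shelstad, §0 p. 480.)  TRANSFER DRESS: «`(G, H)` admits `Δ`-transfer» =
[7] (2.1.1) = the tree's ★ `Rogawski1990.IsDeltaTransferExistsRel R stA sregA T mH mG PG PH` (every `f ∈ C_c^∞(G(F))` has an `f^H ∈ C_c^∞(H(F))` with
`Φ^st(γ_H, f^H) = Σ_{γ_G} Δ(γ_H, γ_G) Φ(γ_G, f)` at ALL strongly `G`-regular `γ_H`), `T` = the transfer factor `Δ` of [6].  The hypothesis «`G` of type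
`A₂`» is a condition on the algebraic group; it travels with this name and cite, in words — the body is the tree's predicate at the data (the
declaration exists so that the consumers can cite the printed Theorem BY NAME).  Print asserts it for EVERY connected reductive `G` of type `A₂`
over a local field `F` of characteristic zero — archimedean or not, ANY residual characteristic (the even case is treated on p. 506) — and every
endoscopic `H`, with `PG = C_c^∞(G(F))`, `PH = C_c^∞(H(F))`.  See the module docstring, «What p. 484 asserts».
[cite: LanglandsShelstad1989, Theorem (end of §2, p. 484); §0 (p. 480); Lemma (p. 506)] [cite: LanglandsShelstad1990Descent, §2.1 (2.1.1) (typescript p. 9); Theorem 2.3.A (typescript p. 12)] -/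
def Theorem_typeA2_DeltaTransfer (R : A → B → Prop) (stA : A → A → Prop) (sregA : A → Prop) (T : TransferFactorData A B R)
    (mH : OrbitalMeasureFamily A) (mG : OrbitalMeasureFamily B) (PG : (B → ℂ) → Prop) (PH : (A → ℂ) → Prop) : Prop :=
  IsDeltaTransferExistsRel R stA sregA T mH mG PG PH

/-- **THEOREM (p. 484), LOCAL FORM — local transfer at the identity (1.1) for every pair `(G, H)` with `G` of type `A₂`, `F` non-archimedean**:
what the paper proves on the way to the Theorem («In the present paper we solve this local problem for two special cases, the group SL(3) … and
the group SU(3), and then conclude that transfer exists for any group of type `A₂`», §0 p. 480; «if local transfer is possible for the pair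
`G_sc, H_sc` then it is possible for `G, H`», p. 484), and the form in which the tree's `U(3)` consumers take p. 484: «`(G′_v, H_v)` admits local
`Δ`-transfer at the identity».  TRANSFER DRESS: ★ `AdmitsLocalDeltaTransferAtIdentity R stA sregA Tloc mH mG PG PH` at the data — every `f ∈ PG` has
`V ∈ 𝓝 1` and `f^H ∈ PH` with `Φ^st(γ_H, f^H) = Σ_{[γ]} Δ_loc(γ_H, γ) Φ([γ], f)` for the strongly `G`-regular `γ_H ∈ V` — token-for-token the conclusion of
`F0_P3a_N6nsGerm.stub_N6nsDyadic` ∕ ★ `Rogawski1990.LocalTransferExplicitNonsplitClosed` at `A = H_v = (U(2) × U(1))(L⁺_v)`, `B = G′_v = U(H′)(L⁺_v)`,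
`Tloc = Δ‴_v`, `PG = PH = IsLocSmooth`.  Print asserts it for every `(G, H)` with `G` of type `A₂` over a NON-ARCHIMEDEAN local field of
characteristic zero, with NO restriction on the residual characteristic (dyadic `F` included: closing Lemma p. 506).
[cite: LanglandsShelstad1989, Theorem (end of §2, p. 484); §0 (p. 480); §1 (1.1) (p. 480); Lemma (p. 506)] [cite: LanglandsShelstad1990Descent, §2.1 (2.1.2) (typescript p. 10)] -/
def Theorem_typeA2_localTransfer (R : A → B → Prop) (stA : A → A → Prop) (sregA : A → Prop) (Tloc : TransferFactorData A B R)
    (mH : OrbitalMeasureFamily A) (mG : OrbitalMeasureFamily B) (PG : (B → ℂ) → Prop) (PH : (A → ℂ) → Prop) : Prop :=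
  AdmitsLocalDeltaTransferAtIdentity R stA sregA Tloc mH mG PG PH

end TheTheorem

end Literature.NumberTheory.Automorphic.LanglandsShelstad1989.Sec2

end
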